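import Mathlib
import Literature.Computability.AlgebraicComplexity.HessianAtOrigin
import Summits.ValiantsHypothesis.ValiantsHypothesis.Theorems.GrenetZeonTwoDimCoefficientsDefs
import Summits.ValiantsHypothesis.ValiantsHypothesis.Theorems.GrenetZeonTwoDimCoefficientsScalingClosureShadow
import Summits.ValiantsHypothesis.ValiantsHypothesis.Theorems.GrenetZeonTwoDimCoefficientsScalingShadowFamily

/-!
# Crux `GrenetZeon.TwoDimCoefficients` (stmt-ValiantsHypothesis-8062), stub `stub_dualUnipotent`:
# scaling-closure — Mignon–Ressayre passes to the SIMPLE FACTORS of the shadow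

The scaling-closure method bounds the Hessian rank of the shadow
`Φ = c + β⁻¹·per_n + Σ_{2≤k≤m/n}[D_k]_{kn}` of a unipotent dual representation by `2m` at every SMOOTH
zero of `Φ` (✓ `rank_hess0_shadow_le`, ✓ `exists_shadowFamily`).  The residual enemy recorded by the 16th
hand (memo SIXTEENTH-HAND.md, R3) is a shadow with balanced companions and no usable smooth zero.  Two
remarks of the 17th hand, typed here:

* `eval_pderiv_pow_eq_zero` — the smooth-zero hypothesis is VOID on multiple factors: a zero of `Q^k`
  (`k ≥ 2`) is never a smooth zero.  So for a shadow of the shape `c·(1 + per_n/(kc·β))^k` (companions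
  `∝ per_n^j`, balanced) the smooth-zero form of the method says nothing: R3 as stated ("a smooth zero of
  `Φ` with Hessian rank `> 2m`") is not the right residual.
* ★ `rank_hess0_transl_le_of_factor`, ★ `rank_hess0_shadow_factor_le`,
  ★ `rank_hess0_factor_le_of_dualUnipotent` — what the method DOES give for free on factors: if
  `Φ = G·U` then at every zero `z₀` of `G` with `U(z₀) ≠ 0` and `∇G(z₀) ≠ 0`,
  `rank Hess G(z₀) ≤ 2m + 2` (product rule ✓ `hess0_mul`: `Hess(GU)(z₀) = U(z₀)·Hess G(z₀) + ∇G∇Uᵀ + ∇U∇Gᵀ`).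
  So every SIMPLE irreducible factor of the shadow inherits the Mignon–Ressayre bound on a dense open part
  of its zero set; the genuinely open case is a MULTIPLE factor (memo SEVENTEENTH-HAND.md, lemma L1′:
  conjecturally the same bound holds at finite `δ` unless `det(A(z/δ) + δⁿB(z/δ))` is a perfect power in
  `ℂ[δ, z]`).

HONEST FRAMING: elementary bookkeeping for a conditional-on-shape method; the stub `DualUnipotentBound`,
the crux and `VP ≠ VNP` remain open.

References: T. Mignon, N. Ressayre, Int. Math. Res. Not. 2004:79, Thm. 1.1 (via the tree).
-/

-- single-conjunct layout `Summits/ValiantsHypothesis/ValiantsHypothesis`: the duplicated namespace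
-- component is mandated by the tree.
set_option linter.dupNamespace false
set_option autoImplicit false

noncomputable section

namespace Summit.ValiantsHypothesis.ValiantsHypothesis.Theorems.GrenetZeonTwoDimCoefficients.ScalingClosure

open MvPolynomial Matrix
open Literature.Computability.AlgebraicComplexity
open Summit.ValiantsHypothesis.ValiantsHypothesis.Cruxes.TwoDimCoefficients.DimTwoCases

/-! ### Multiple factors have no smooth zeros -/

section Power

variable {k : Type*} [Field k] {σ : Type*}

/-- **A zero of a power `Q^j` (`j ≥ 2`) is never smooth**: all first partials of `Q^j` vanish there.  (So
the smooth-zero form of the scaling-closure bound is void on multiple factors of the shadow.) [folklore] -/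
theorem eval_pderiv_pow_eq_zero (Q : MvPolynomial σ k) {j : ℕ} (hj : 2 ≤ j) (z : σ → k)
    (hz : eval z (Q ^ j) = 0) (i : σ) : eval z (pderiv i (Q ^ j)) = 0 := by
  have hQ : eval z Q = 0 := by
    rw [map_pow] at hz
    exact pow_eq_zero_iff (by omega) |>.mp hz
  obtain ⟨l, rfl⟩ : ∃ l, j = l + 2 := ⟨j - 2, by omega⟩
  rw [pderiv_pow, map_mul, map_mul, map_pow, hQ, show l + 2 - 1 = l + 1 by omega, zero_pow (by omega),
    mul_zero, zero_mul]

/-- A zero of `G` off `Z(U)` with `∂_i G ≠ 0` is a smooth zero of `G·U`. [folklore] -/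
theorem eval_pderiv_mul_ne_zero_of_factor (G U : MvPolynomial σ k) (z : σ → k) (hG : eval z G = 0)
    (hU : eval z U ≠ 0) (i : σ) (hi : eval z (pderiv i G) ≠ 0) :
    eval z (pderiv i (G * U)) ≠ 0 := by
  rw [pderiv_mul, map_add, map_mul, map_mul, hG, zero_mul, add_zero]
  exact mul_ne_zero hi hU

end Power

/-! ### Hessian rank passes to simple factors -/

section Factor

variable {k : Type*} [Field k] {σ : Type*} [Fintype σ] [DecidableEq σ]

omit [DecidableEq σ] in
/-- Rank is subadditive (matrices over a field). [folklore] -/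
theorem rank_add_le_rank_add (M N : Matrix σ σ k) : (M + N).rank ≤ M.rank + N.rank := by
  rw [Matrix.rank, Matrix.rank, Matrix.rank, Matrix.mulVecLin_add]
  exact (Submodule.finrank_mono (LinearMap.range_add_le _ _)).trans
    (Submodule.finrank_add_le_finrank_add_finrank _ _)

/-- Scaling does not increase rank. [folklore] -/
theorem rank_smul_le (a : k) (M : Matrix σ σ k) : (a • M).rank ≤ M.rank := by
  rw [show a • M = (a • (1 : Matrix σ σ k)) * M by rw [Matrix.smul_mul, Matrix.one_mul]]
  exact Matrix.rank_mul_le_right _ _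

/-- ★ **Hessian rank passes to a simple factor.**  If `G(z) = 0` and `U(z) ≠ 0` then
`rank Hess G(z) ≤ rank Hess(G·U)(z) + 2` (`Hess(GU)(z) = U(z)·Hess G(z) + ∇G∇Uᵀ + ∇U∇Gᵀ`). [folklore] -/
theorem rank_hess0_transl_le_of_factor (G U : MvPolynomial σ k) (z : σ → k) (hG : eval z G = 0)
    (hU : eval z U ≠ 0) :
    (hess0 (transl z G)).rank ≤ (hess0 (transl z (G * U))).rank + 2 := by
  have hprod := hess0_mul (transl z G) (transl z U)
  rw [← map_mul, constantCoeff_transl, constantCoeff_transl, hG, zero_smul, zero_add] at hprod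
  -- `Hess G = U(z)⁻¹ • (Hess(GU) - R)` with `rank R ≤ 2`
  set R := vecMulVec (linPart (transl z G)) (linPart (transl z U)) +
    vecMulVec (linPart (transl z U)) (linPart (transl z G)) with hR
  have hsolve : hess0 (transl z G) = (eval z U)⁻¹ • hess0 (transl z (G * U)) + (eval z U)⁻¹ • (-R) := by
    rw [hprod, smul_add, smul_neg, smul_smul, inv_mul_cancel₀ hU, one_smul, add_neg_cancel_right]
  have hRk : R.rank ≤ 2 := by
    refine (rank_add_le_rank_add _ _).trans ?_
    have h1 := Matrix.rank_vecMulVec_le (linPart (transl z G)) (linPart (transl z U))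
    have h2 := Matrix.rank_vecMulVec_le (linPart (transl z U)) (linPart (transl z G))
    omega
  rw [hsolve]
  refine (rank_add_le_rank_add _ _).trans ?_
  have h1 := rank_smul_le (eval z U)⁻¹ (hess0 (transl z (G * U)))
  have h2 : ((eval z U)⁻¹ • (-R)).rank ≤ 2 := by
    refine (rank_smul_le _ _).trans ?_
    rw [show -R = (-1 : k) • R by rw [neg_one_smul]]
    exact (rank_smul_le _ _).trans hRk
  omega

end Factor

/-! ### The shadow: simple factors inherit the slice bound -/

section Shadow

variable {σ : Type*} [Fintype σ] [DecidableEq σ]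

/-- ★ **Mignon–Ressayre passes to simple factors of the shadow.**  In the setting of
✓ `rank_hess0_shadow_le` (`P(z, 0) = Φ(z)`, slice bound `r` off `δ = 0`): if `Φ = G·U`, then at every zero
`z₀` of `G` with `U(z₀) ≠ 0` and some `∂_i G(z₀) ≠ 0`, `rank Hess G(z₀) ≤ r + 2`. [folklore] -/
theorem rank_hess0_shadow_factor_le (P : MvPolynomial (Option σ) ℂ) (G U : MvPolynomial σ ℂ) (r : ℕ)
    (h0 : ∀ z : σ → ℂ, eval (fun o : Option σ => o.elim (0 : ℂ) z) P = eval z (G * U))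
    (hMR : ∀ x : Option σ → ℂ, x none ≠ 0 → eval x P = 0 →
      ((Matrix.of fun s t : σ => pderiv (some s) (pderiv (some t) P)).map (eval x)).rank ≤ r)
    (z₀ : σ → ℂ) (hG : eval z₀ G = 0) (hU : eval z₀ U ≠ 0) (i : σ) (hi : eval z₀ (pderiv i G) ≠ 0) :
    (hess0 (transl z₀ G)).rank ≤ r + 2 := by
  have hz : eval z₀ (G * U) = 0 := by rw [map_mul, hG, zero_mul]
  have h := rank_hess0_shadow_le P (G * U) r h0 hMR z₀ hz i
    (eval_pderiv_mul_ne_zero_of_factor G U z₀ hG hU i hi)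
  exact (rank_hess0_transl_le_of_factor G U z₀ hG hU).trans (by omega)

/-- ★ **Simple factors of the shadow of a unipotent dual representation.**  Let `per_n = α·c + β·tr(adj A·B)`
(`det A = c ≠ 0`, `A, B` affine `m × m`, `n ≥ 1`, `m ≥ 2`) with `deg D_k ≤ k·n` for `k ≥ 2`
(`D_k = [X^k] det(X·B + A)`), and let the shadow factor as
`c + β⁻¹·per_n + Σ_{2≤k≤m}[D_k]_{kn} = G·U`.  Then at every zero `z₀` of `G` with `U(z₀) ≠ 0` and some
`∂_i G(z₀) ≠ 0`: `rank Hess G(z₀) ≤ 2m + 2`.  (For a SIMPLE irreducible factor `G` such `z₀` are dense in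
`Z(G)`.) [cite: MignonRessayre2004, Thm. 1.1 — via the tree; folklore] -/
theorem rank_hess0_factor_le_of_dualUnipotent {n m : ℕ} (A B : AffMat n m) (hA : IsAffine A)
    (hB : IsAffine B) (α β c : ℂ) (hc : c ≠ 0) (hβ : β ≠ 0) (hdet : A.det = MvPolynomial.C c)
    (hper : perPoly (Fin n) ℂ = MvPolynomial.C α * A.det + MvPolynomial.C β * (A.adjugate * B).trace)
    (hn : 1 ≤ n) (hm2 : 2 ≤ m) (D : ℕ → MvPolynomial (Fin n × Fin n) ℂ)
    (hD : ∀ j, D j = (det ((Polynomial.X : Polynomial (MvPolynomial (Fin n × Fin n) ℂ)) •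
      B.map Polynomial.C + A.map Polynomial.C)).coeff j)
    (hdeg : ∀ j, 2 ≤ j → ∀ d, j * n < d → homogeneousComponent d (D j) = 0)
    (G U : MvPolynomial (Fin n × Fin n) ℂ)
    (hfac : MvPolynomial.C c + MvPolynomial.C β⁻¹ * perPoly (Fin n) ℂ +
      (∑ j ∈ Finset.range (m + 1), if 2 ≤ j then homogeneousComponent (j * n) (D j) else 0) = G * U)
    (z₀ : Fin n × Fin n → ℂ) (hG : eval z₀ G = 0) (hU : eval z₀ U ≠ 0) (i : Fin n × Fin n)
    (hi : eval z₀ (pderiv i G) ≠ 0) :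
    (hess0 (transl z₀ G)).rank ≤ 2 * m + 2 := by
  classical
  obtain ⟨P, h0, hMR⟩ := exists_shadowFamily A B hA hB α β c hc hβ hdet hper hn hm2 D hD hdeg
  refine rank_hess0_shadow_factor_le P G U (2 * m) (fun z => ?_) hMR z₀ hG hU i hi
  rw [h0 z, hfac]

end Shadow

end Summit.ValiantsHypothesis.ValiantsHypothesis.Theorems.GrenetZeonTwoDimCoefficients.ScalingClosure

end
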